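import Summits.Langlands.Langlands.Theorems.IrreducibilityBySelfDualityReciprocityUpToIrreducibilityAboveUnramified
import HarnessLib

/-!
# Line `Sketch` for the crux `ReciprocityUpToIrreducibility` (item stmt-Langlands-14328), continuation c8,
# wave N9 (stub C): the `v ∣ ℓ` clause on the POTENTIALLY UNRAMIFIED sector, relative to the pinned datum

Support file (closes nothing; stub N9-C `stub_localGlobalCompatibleAt_above_iff_of_potentiallyUnramified`
of the registered skeleton `Lines/Sketch.lean`, continuation lead c8, prover-line-stmt-Langlands-14328-c8-0).

At a place `v ∣ ℓ` the summit's local–global clause `LocalGlobalCompatibleAt Rec ι π ρ v` asks for a local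
component `π_v` of `π`, a Weil–Deligne representation `r` attached to `ρ|_{Γ_{K_v}}` by the PINNED Fontaine
datum `Rec.pst ℓ v hv` — by definition the Literature term `fontainePstAdicCompletion v ℓ hv` — a transport
`rℂ = ι(r)` along `ι : ℚ̄_ℓ ≃ ℂ`, and `rℂ^{F-ss}` of class `rec_v(π_v)`.  Continuation c3
(`…ReciprocityUpToIrreducibilityAboveUnramified.lean`) proved, for `ρ` UNRAMIFIED at `v` and under
`FontaineDatumExists`, that the clause is equivalent to the `ℓ`-blind matching "some local component `π_v`
of `π` has `rec_v(π_v) =` the Frobenius-semisimple class of a transport of `(ρ|_{W_{K_v}}, N = 0)` along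
`ι`", from clause (F8) of `IsFontaineDatum` in the form: SOME `r` is attached to `ρ|_{Γ_{K_v}}` by the pinned
datum, and EVERY attached `r` is `≅ (ρ|_{W_{K_v}}, 0)`.

For Fontaine's genuine datum the same normalisation holds on every representation with finite inertia
image (potentially unramified ⇒ potentially crystalline of weight `0`, `D_pst(ρ) = F'₀ ⊗ ρ`,
`WD(D_pst ρ) ≅ (ρ|_{W_F}, N = 0)`; Fontaine 1994, Exp. VIII §1.3, §2.3.7) — the lead's proposed clause (F9).
This file proves the consequences RELATIVE TO THAT BEHAVIOUR ON THE GIVEN PAIR `(ρ, v)`, for an ARBITRARY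
continuity witness `hc` of `ρ|_{W_{K_v}}` (so: the potentially unramified / finite-inertia sector):

* `localGlobalCompatibleAt_above_of_isEquivalent_ofRep` (`⇐`): if the pinned datum attaches to
  `ρ|_{Γ_{K_v}}` some `r₀ ≅ (ρ|_{W_{K_v}}, 0)`, then a local component `π_v` of `π` at `v` and a transport
  `rℂ` of `(ρ|_{W_{K_v}}, 0)` along `ι` with `rℂ^{F-ss}` of class `rec_v(π_v)` witness the clause;
* `exists_of_localGlobalCompatibleAt_above_of_forall_isEquivalent` (`⇒`): if every attached `r` is
  `≅ (ρ|_{W_{K_v}}, 0)`, the clause yields such a pair `(π_v, rℂ)`;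
* `localGlobalCompatibleAt_above_iff_of_forall_isEquivalent`: the iff under both hypotheses, and the
  registered stub signature verbatim, `stub_localGlobalCompatibleAt_above_iff_of_potentiallyUnramified`;
* sanity (`localGlobalCompatibleAt_above_iff_of_isUnramifiedAt_of_isContinuousRep`): c3's unramified iff,
  for any continuity witness, is the special case fed by (F8),
  `fontainePstAdicCompletion_isWeilDeligneOf_of_isUnramifiedAt hF ρ hρ hv`.

The proofs are c3's, verbatim up to the hypotheses: every Weil–Deligne representation on `ℚ̄_ℓⁿ` has a
transport along `ι` (`exists_isTransportAlong`), transports of isomorphic Weil–Deligne representations are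
isomorphic (`isEquivalent_of_isTransportAlong`), and the Frobenius-semisimple class is an isomorphism
invariant (`hasFrobSemisimpleClass_of_isEquivalent`).  Nothing unregistered is assumed: no named fact enters
the stub (not even `FontaineDatumExists`, which appears only in the sanity corollary), the two (F9)-shaped
facts being hypotheses on the pair.  No definitions; std axioms.
-/

noncomputable section

set_option linter.dupNamespace false -- project-wide option (lakefile weak.linter.dupNamespace); `Summit.Langlands.Langlands` is the mandated namespace

open scoped MatrixGroups Matrix NumberField Classical
open Filter IsDedekindDomain Field
open Literature.NumberTheory.Automorphic Literature.NumberTheory.GaloisRepresentations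
open Literature.NumberTheory.PAdicHodge
open Summit.Langlands

namespace Summit.Langlands.Langlands.Theorems.ReciprocityUpToIrreducibility

/-! ## 1. The `v ∣ ℓ` clause relative to the pinned datum's behaviour on the pair `(ρ, v)` -/

section Summit

variable {K : Type} [Field K] [NumberField K] {ℓ : ℕ} [Fact ℓ.Prime] {n : ℕ}
  {hcpt : isCompact_glFiniteIntegralLevel n K}

/-- **Potentially unramified sector, `⇐`: the `ℓ`-blind matching gives local–global compatibility above
`ℓ`.**  Let `v ∣ ℓ`, let `hc` be any continuity witness for `ρ|_{W_{K_v}}`, and suppose the pinned datum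
`fontainePstAdicCompletion v ℓ hv` attaches to `ρ|_{Γ_{K_v}}` some `r₀ ≅ (ρ|_{W_{K_v}}, N = 0)` (clause
(F8) for `ρ` unramified at `v`; Fontaine, Exp. VIII §1.3, §2.3.7 for finite inertia image).  If `π_v` is
a local component of `π` at `v` and `rℂ` a transport of `(ρ|_{W_{K_v}}, 0)` along `ι` with `rℂ^{F-ss}` of
class `rec_v(π_v)`, then `LocalGlobalCompatibleAt Rec ι π ρ v`: transport `r₀` along `ι`
(`exists_isTransportAlong`); isomorphic representations have isomorphic transports
(`isEquivalent_of_isTransportAlong`), and the Frobenius-semisimple class is an isomorphism invariant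
(`hasFrobSemisimpleClass_of_isEquivalent`); the `v ∤ ℓ` conjunct is vacuous and `Rec.pst ℓ v _` is the
pinned datum by definition. [cite: FontaineAsterisque223VIII, §1.3 and §2.3.7]
[cite: DeligneAntwerpII1973, §8.4.3 and §8.6] -/
theorem localGlobalCompatibleAt_above_of_isEquivalent_ofRep
    (Rec : ReciprocityData K) (ι : PadicAlgCl ℓ ≃+* ℂ)
    (π : AutomorphicRepData (AutomorphyDatum.gl n K hcpt)) (ρ : FramedGaloisRep K (PadicAlgCl ℓ) n)
    {v : HeightOneSpectrum (𝓞 K)} (hv : ((ℓ : ℕ) : 𝓞 K) ∈ v.asIdeal)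
    {hc : WeilGroup.IsContinuousRep ((ρ.toLocal v).weilRestrict (v.adicCompletion K))}
    {r₀ : WeilDeligneRep (v.adicCompletion K) (PadicAlgCl ℓ) (Fin n → PadicAlgCl ℓ)}
    (hr₀ : (fontainePstAdicCompletion v ℓ hv).IsWeilDeligneOf (ρ.toLocal v) r₀)
    (he : r₀.IsEquivalent (WeilDeligneRep.ofRep ((ρ.toLocal v).weilRestrict (v.adicCompletion K)) hc))
    (πv : SmoothIrrep (GL (Fin n) (v.adicCompletion K))) (hπv : π.HasLocalComponentAt v πv.ρ)
    (rℂ : WeilDeligneRep (v.adicCompletion K) ℂ (Fin n → ℂ))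
    (htr : (WeilDeligneRep.ofRep ((ρ.toLocal v).weilRestrict (v.adicCompletion K)) hc).IsTransportAlong
      (ι : PadicAlgCl ℓ →+* ℂ) rℂ)
    (hcls : rℂ.HasFrobSemisimpleClass ((Rec.llc v).recGL n (IrrClass.mk πv))) :
    LocalGlobalCompatibleAt Rec ι π ρ v := by
  obtain ⟨rℂ₀, htr₀⟩ := exists_isTransportAlong (ι : PadicAlgCl ℓ →+* ℂ) r₀
  obtain ⟨e⟩ := isEquivalent_of_isTransportAlong _ he htr₀ htr
  exact ⟨πv, r₀, rℂ₀, hπv, fun h => absurd hv h, fun _ => hr₀, htr₀,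
    hasFrobSemisimpleClass_of_isEquivalent ⟨e.symm⟩ hcls⟩

/-- **Potentially unramified sector, `⇐`, from the two (F9)-shaped facts on the pair.**  Same as
`localGlobalCompatibleAt_above_of_isEquivalent_ofRep`, with the hypotheses in the registered form: SOME `r`
is attached to `ρ|_{Γ_{K_v}}` by the pinned datum, and EVERY attached `r` is `≅ (ρ|_{W_{K_v}}, N = 0)`.
[cite: FontaineAsterisque223VIII, §1.3 and §2.3.7] [cite: DeligneAntwerpII1973, §8.4.3 and §8.6] -/
theorem localGlobalCompatibleAt_above_of_forall_isEquivalent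
    (Rec : ReciprocityData K) (ι : PadicAlgCl ℓ ≃+* ℂ)
    (π : AutomorphicRepData (AutomorphyDatum.gl n K hcpt)) (ρ : FramedGaloisRep K (PadicAlgCl ℓ) n)
    {v : HeightOneSpectrum (𝓞 K)} (hv : ((ℓ : ℕ) : 𝓞 K) ∈ v.asIdeal)
    {hc : WeilGroup.IsContinuousRep ((ρ.toLocal v).weilRestrict (v.adicCompletion K))}
    (hex : ∃ r, (fontainePstAdicCompletion v ℓ hv).IsWeilDeligneOf (ρ.toLocal v) r)
    (huniq : ∀ r, (fontainePstAdicCompletion v ℓ hv).IsWeilDeligneOf (ρ.toLocal v) r →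
      r.IsEquivalent (WeilDeligneRep.ofRep ((ρ.toLocal v).weilRestrict (v.adicCompletion K)) hc))
    (πv : SmoothIrrep (GL (Fin n) (v.adicCompletion K))) (hπv : π.HasLocalComponentAt v πv.ρ)
    (rℂ : WeilDeligneRep (v.adicCompletion K) ℂ (Fin n → ℂ))
    (htr : (WeilDeligneRep.ofRep ((ρ.toLocal v).weilRestrict (v.adicCompletion K)) hc).IsTransportAlong
      (ι : PadicAlgCl ℓ →+* ℂ) rℂ)
    (hcls : rℂ.HasFrobSemisimpleClass ((Rec.llc v).recGL n (IrrClass.mk πv))) :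
    LocalGlobalCompatibleAt Rec ι π ρ v := by
  obtain ⟨r₀, hr₀⟩ := hex
  exact localGlobalCompatibleAt_above_of_isEquivalent_ofRep Rec ι π ρ hv hr₀ (huniq r₀ hr₀) πv hπv
    rℂ htr hcls

/-- **Potentially unramified sector, `⇒`.**  Let `v ∣ ℓ`, `hc` any continuity witness for
`ρ|_{W_{K_v}}`, and suppose EVERY Weil–Deligne representation attached to `ρ|_{Γ_{K_v}}` by the pinned
datum is `≅ (ρ|_{W_{K_v}}, N = 0)`.  Then local–global compatibility at `v` yields a local component
`π_v` of `π` at `v` and a transport `rℂ` of `(ρ|_{W_{K_v}}, 0)` along `ι` with `rℂ^{F-ss}` of class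
`rec_v(π_v)`: the attached `r` of the clause is `≅ (ρ|_{W_{K_v}}, 0)`, any transport of the latter
(`exists_isTransportAlong`) is isomorphic to the clause's `ι(r)` (`isEquivalent_of_isTransportAlong`), and
the class moves along the isomorphism (`hasFrobSemisimpleClass_of_isEquivalent`).
[cite: FontaineAsterisque223VIII, §2.3.7] [cite: DeligneAntwerpII1973, §8.6] -/
theorem exists_of_localGlobalCompatibleAt_above_of_forall_isEquivalent
    (Rec : ReciprocityData K) (ι : PadicAlgCl ℓ ≃+* ℂ)
    (π : AutomorphicRepData (AutomorphyDatum.gl n K hcpt)) (ρ : FramedGaloisRep K (PadicAlgCl ℓ) n)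
    {v : HeightOneSpectrum (𝓞 K)} (hv : ((ℓ : ℕ) : 𝓞 K) ∈ v.asIdeal)
    {hc : WeilGroup.IsContinuousRep ((ρ.toLocal v).weilRestrict (v.adicCompletion K))}
    (huniq : ∀ r, (fontainePstAdicCompletion v ℓ hv).IsWeilDeligneOf (ρ.toLocal v) r →
      r.IsEquivalent (WeilDeligneRep.ofRep ((ρ.toLocal v).weilRestrict (v.adicCompletion K)) hc))
    (h : LocalGlobalCompatibleAt Rec ι π ρ v) :
    ∃ (πv : SmoothIrrep (GL (Fin n) (v.adicCompletion K)))
      (rℂ : WeilDeligneRep (v.adicCompletion K) ℂ (Fin n → ℂ)),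
      π.HasLocalComponentAt v πv.ρ ∧
        (WeilDeligneRep.ofRep ((ρ.toLocal v).weilRestrict (v.adicCompletion K)) hc).IsTransportAlong
          (ι : PadicAlgCl ℓ →+* ℂ) rℂ ∧
        rℂ.HasFrobSemisimpleClass ((Rec.llc v).recGL n (IrrClass.mk πv)) := by
  obtain ⟨πv, r, rℂ, hπv, -, hpst, htr, hcls⟩ := h
  have he := huniq r (hpst hv)
  obtain ⟨rℂ₁, htr₁⟩ := exists_isTransportAlong (ι : PadicAlgCl ℓ →+* ℂ)
    (WeilDeligneRep.ofRep ((ρ.toLocal v).weilRestrict (v.adicCompletion K)) hc)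
  exact ⟨πv, rℂ₁, hπv, htr₁,
    hasFrobSemisimpleClass_of_isEquivalent (isEquivalent_of_isTransportAlong _ he htr htr₁) hcls⟩

/-- **On the potentially unramified sector the `v ∣ ℓ` clause IS the `ℓ`-blind matching, relative to
the pinned datum's behaviour on the pair.**  Let `v ∣ ℓ` and `hc` any continuity witness for
`ρ|_{W_{K_v}}`; suppose the pinned datum attaches SOME `r` to `ρ|_{Γ_{K_v}}` and every attached `r` is
`≅ (ρ|_{W_{K_v}}, N = 0)` (clause (F8) of `IsFontaineDatum` for `ρ` unramified at `v`; the behaviour of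
Fontaine's `WD ∘ D_pst` on every representation with finite inertia image, Exp. VIII §1.3, §2.3.7).  Then
`LocalGlobalCompatibleAt Rec ι π ρ v` holds iff some local component `π_v` of `π` at `v` has `rec_v(π_v)`
equal to the Frobenius-semisimple class of a transport of `(ρ|_{W_{K_v}}, 0)` along `ι` — the statement
the clause makes at a place `v ∤ ℓ` of finite inertia image (c7's
`localGlobalCompatibleAt_away_iff_of_isContinuousRep`). [cite: FontaineAsterisque223VIII, §1.3 and §2.3.7]
[cite: BuzzardGeeLMS2014, Conj. 3.2.2] -/
theorem localGlobalCompatibleAt_above_iff_of_forall_isEquivalent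
    (Rec : ReciprocityData K) (ι : PadicAlgCl ℓ ≃+* ℂ)
    (π : AutomorphicRepData (AutomorphyDatum.gl n K hcpt)) (ρ : FramedGaloisRep K (PadicAlgCl ℓ) n)
    {v : HeightOneSpectrum (𝓞 K)} (hv : ((ℓ : ℕ) : 𝓞 K) ∈ v.asIdeal)
    {hc : WeilGroup.IsContinuousRep ((ρ.toLocal v).weilRestrict (v.adicCompletion K))}
    (hex : ∃ r, (fontainePstAdicCompletion v ℓ hv).IsWeilDeligneOf (ρ.toLocal v) r)
    (huniq : ∀ r, (fontainePstAdicCompletion v ℓ hv).IsWeilDeligneOf (ρ.toLocal v) r →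
      r.IsEquivalent (WeilDeligneRep.ofRep ((ρ.toLocal v).weilRestrict (v.adicCompletion K)) hc)) :
    LocalGlobalCompatibleAt Rec ι π ρ v ↔
      ∃ (πv : SmoothIrrep (GL (Fin n) (v.adicCompletion K)))
        (rℂ : WeilDeligneRep (v.adicCompletion K) ℂ (Fin n → ℂ)),
        π.HasLocalComponentAt v πv.ρ ∧
          (WeilDeligneRep.ofRep ((ρ.toLocal v).weilRestrict (v.adicCompletion K)) hc).IsTransportAlong
            (ι : PadicAlgCl ℓ →+* ℂ) rℂ ∧
          rℂ.HasFrobSemisimpleClass ((Rec.llc v).recGL n (IrrClass.mk πv)) :=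
  ⟨exists_of_localGlobalCompatibleAt_above_of_forall_isEquivalent Rec ι π ρ hv huniq,
    fun ⟨πv, rℂ, hπv, htr, hcls⟩ =>
      localGlobalCompatibleAt_above_of_forall_isEquivalent Rec ι π ρ hv hex huniq πv hπv rℂ htr hcls⟩

/-- **Registered stub N9-C of line `Sketch` (crux stmt-Langlands-14328; every rank, every `Rec`, `v ∣ ℓ`,
finite inertia image): relative to the pinned datum attaching `(ρ|_{W_{K_v}}, 0)` to `ρ|_{Γ_{K_v}}`, the
`v ∣ ℓ` clause IS the `ℓ`-blind matching** — the `v ∣ ℓ` twin of c7's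
`localGlobalCompatibleAt_away_iff_of_isContinuousRep` and the potentially-unramified generalisation of c3's
`localGlobalCompatibleAt_above_iff_of_isUnramifiedAt`; closed form of
`localGlobalCompatibleAt_above_iff_of_forall_isEquivalent` (same proof: transports of isomorphic
Weil–Deligne representations are isomorphic, the Frobenius-semisimple class is an isomorphism invariant).
[cite: FontaineAsterisque223VIII, §1.3 and §2.3.7] [cite: DeligneAntwerpII1973, §8.4.3 and §8.6] -/
theorem stub_localGlobalCompatibleAt_above_iff_of_potentiallyUnramified :
    ∀ (K : Type) [Field K] [NumberField K] (ℓ : ℕ) [Fact ℓ.Prime] (n : ℕ)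
      (hcpt : isCompact_glFiniteIntegralLevel n K) (Rec : ReciprocityData K) (ι : PadicAlgCl ℓ ≃+* ℂ)
      (π : AutomorphicRepData (AutomorphyDatum.gl n K hcpt)) (ρ : FramedGaloisRep K (PadicAlgCl ℓ) n)
      (v : HeightOneSpectrum (𝓞 K)) (hv : ((ℓ : ℕ) : 𝓞 K) ∈ v.asIdeal)
      (hc : WeilGroup.IsContinuousRep ((ρ.toLocal v).weilRestrict (v.adicCompletion K))),
      (∃ r, (Literature.NumberTheory.PAdicHodge.fontainePstAdicCompletion v ℓ hv).IsWeilDeligneOf (ρ.toLocal v) r) →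
      (∀ r, (Literature.NumberTheory.PAdicHodge.fontainePstAdicCompletion v ℓ hv).IsWeilDeligneOf (ρ.toLocal v) r →
        r.IsEquivalent (WeilDeligneRep.ofRep ((ρ.toLocal v).weilRestrict (v.adicCompletion K)) hc)) →
      (LocalGlobalCompatibleAt Rec ι π ρ v ↔
        ∃ (πv : SmoothIrrep (GL (Fin n) (v.adicCompletion K)))
          (rℂ : WeilDeligneRep (v.adicCompletion K) ℂ (Fin n → ℂ)),
          π.HasLocalComponentAt v πv.ρ ∧
            (WeilDeligneRep.ofRep ((ρ.toLocal v).weilRestrict (v.adicCompletion K)) hc).IsTransportAlong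
              (ι : PadicAlgCl ℓ →+* ℂ) rℂ ∧
            rℂ.HasFrobSemisimpleClass ((Rec.llc v).recGL n (IrrClass.mk πv))) := by
  intro K _ _ ℓ _ n hcpt Rec ι π ρ v hv hc hex huniq
  exact localGlobalCompatibleAt_above_iff_of_forall_isEquivalent Rec ι π ρ hv hex huniq

/-! ## 2. Sanity: the unramified sector (c3, clause (F8)) is the special case -/

/-- **Sanity: c3's unramified iff is the special case of the potentially unramified one.**  Under
`FontaineDatumExists`, for `ρ` unramified at `v ∣ ℓ` clause (F8) of the pinned datum supplies exactly the
two hypotheses of `localGlobalCompatibleAt_above_iff_of_forall_isEquivalent`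
(`fontainePstAdicCompletion_isWeilDeligneOf_of_isUnramifiedAt hF ρ hρ hv`), so
`LocalGlobalCompatibleAt Rec ι π ρ v` is the `ℓ`-blind matching for ANY continuity witness `hc` of
`ρ|_{W_{K_v}}`; c3's `localGlobalCompatibleAt_above_iff_of_isUnramifiedAt` is the instance
`hc := (isLocallyUnramified_toLocal_of_isUnramifiedAt ρ v hρ).isUnramifiedRep_weilRestrict.isContinuousRep`
(all witnesses give the same `WeilDeligneRep.ofRep`; not restated here, it is the landed declaration).
[cite: FontaineAsterisque223VIII, §2.3.7]
[cite: TateCorvallis1979, (4.1.3)–(4.2.1)] -/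
theorem localGlobalCompatibleAt_above_iff_of_isUnramifiedAt_of_isContinuousRep (hF : FontaineDatumExists)
    (Rec : ReciprocityData K) (ι : PadicAlgCl ℓ ≃+* ℂ)
    (π : AutomorphicRepData (AutomorphyDatum.gl n K hcpt)) (ρ : FramedGaloisRep K (PadicAlgCl ℓ) n)
    {v : HeightOneSpectrum (𝓞 K)} (hv : ((ℓ : ℕ) : 𝓞 K) ∈ v.asIdeal) (hρ : ρ.IsUnramifiedAt v)
    (hc : WeilGroup.IsContinuousRep ((ρ.toLocal v).weilRestrict (v.adicCompletion K))) :
    LocalGlobalCompatibleAt Rec ι π ρ v ↔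
      ∃ (πv : SmoothIrrep (GL (Fin n) (v.adicCompletion K)))
        (rℂ : WeilDeligneRep (v.adicCompletion K) ℂ (Fin n → ℂ)),
        π.HasLocalComponentAt v πv.ρ ∧
          (WeilDeligneRep.ofRep ((ρ.toLocal v).weilRestrict (v.adicCompletion K)) hc).IsTransportAlong
            (ι : PadicAlgCl ℓ →+* ℂ) rℂ ∧
          rℂ.HasFrobSemisimpleClass ((Rec.llc v).recGL n (IrrClass.mk πv)) :=
  have h8 := fontainePstAdicCompletion_isWeilDeligneOf_of_isUnramifiedAt hF ρ hρ hv
  localGlobalCompatibleAt_above_iff_of_forall_isEquivalent Rec ι π ρ hv h8.1 h8.2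

end Summit

end Summit.Langlands.Langlands.Theorems.ReciprocityUpToIrreducibility

end
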